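import Summits.BirchSwinnertonDyer.Rank1Residual.AdditivePotMult.SelmerCotorsionTransferOdd
import Summits.BirchSwinnertonDyer.Rank1Residual.AdditivePotMult.NonPrimitiveLambdaTransferOdd
import Summits.BirchSwinnertonDyer.Rank1Residual.AdditivePotMult.NonPrimitiveDualNoFiniteSubmodule
import Summits.BirchSwinnertonDyer.Rank1Residual.Additive.RamifiedOrdinaryLineQuotientInvariantsModelFree
import HarnessLib

/-!
# GV's transfer along ONE given congruence `e : E₁[p] ≃ E₂[p]` matching the ramified ordinary lines:
# the count, `#Sel^{Σ₀}[p]` equality, and the A240-shaped CORE (cell `b2b-bsdres`, team n1011, seat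
# p12 (gen 6); row T-A240-K, FILE K4a — everything of the A240 assembly that does not wait on
# n1011-lit's T-GV23L record / p06's T-A240-PORT transport, checked now)

HONEST FRAMING (cell `b2b-bsdres`, run/shared/lean/b2b/bsd-rank1-residual/, verbatim in every
file): the goal of the cell is to DELETE the COMBINATION-SHAPED residual classes of the
Birch–Swinnerton-Dyer formula for ALL analytic-rank `≤ 1` elliptic curves over `ℚ` — "full BSD
formula for every rank `≤ 1` curve in class `C`" assembled STRICTLY from published theorems — so
that the rank-`≤ 1` remainder becomes exactly the CONSTRUCTION-SHAPED classes, which are TYPED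
(missing-input `Prop`s), NOT attempted. This is not "finishing BSD". Team n1011: research routes on
CONSTRUCTION-SHAPED classes; prove what is provable now; no claim beyond stated classes; census
output = EVIDENCE, never a Literature fact; RESIDUAL-MAP marks UNCHANGED; nothing is booked by this
file. THEOREMS ONLY: no definition, no named fact (A234 enters as the displayed binder `h414`; GV
Cor. (2.3)/(2.4) enter as the displayed per-side binders `hrec₁ hrec₂ hdiv₁ hdiv₂`, to be discharged
from n1011-lit's T-GV23L record in FILE K4).

## What and why

cc-typer-2's composed record A240 (`muLambdaAlg_transfer_of_torsionIso_potOrd_of_not_dvd_torsionOrder`)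
quantifies over ONE `Γ_ℚ`-equivariant `e : E₁[p] ≃+ E₂[p]` carrying `C₁[p]` onto `C₂[p]`; the gen-5
assembly (`…_of_forall_lines`) asked matching of EVERY such `e` — harmless on the `e = 2` loci
(p07/p10 matching theorems) but not A240's literal hypothesis, and genuinely weaker in the reducible
case. THIS FILE redoes the assembly along the ONE given `e`:

* §1 `exists_transport_of_congruence (e) (he)` — `θ : E₁[p^∞][p] ≃+ E₂[p^∞][p]` equivariant with
  `θ(E₁[p^∞][p] ∩ C₁) = E₂[p^∞][p] ∩ C₂` for every pair of local data matched by `e`;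
* §2 `exists_data_natCard_gvSelmerInfty_inf_torsion_eq_of_congruence` — GV's COUNT
  `#(S^{S₀}_{E₁[p^∞]}(ℚ_∞) ⊓ H¹[p]) = #(S^{S₀}_{E₂[p^∞]}(ℚ_∞) ⊓ H¹[p])` (`p` odd, any `ℤ_p`-extension; the
  Remark-(2.9) clauses by `gr_invariants_eq_zero_of_isRamifiedOrdinaryLine`, T-GV29-MF);
  `natCard_torsionBy_nonPrimitiveSelmerInfty_eq_of_congruence` — `#Sel^{Σ₀}_{E₁}[p] = #Sel^{Σ₀}_{E₂}[p]`
  (`κ` cyclotomic; the R-D identification asked of the ramified ordinary lines at `v ∋ p`, per `κ`);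
* §3 **`mu_eq_zero_and_lambda_add_sum_delta_eq_of_congruence`** — THE A240-SHAPED CORE: from `D₁`
  torsion with `μ = 0` (+ A240's binders), the per-side record consequences `hrecᵢ` (`X^{Σ₀}_i`
  torsion, `μ(X^{Σ₀}_i) = μ(X_i)`, `λ(X^{Σ₀}_i) = λ(X_i) + Σδ_i`), the divisibility `hdivᵢ` of
  `Sel^{Σ₀}_i/Sel_i` and `h414`: **`μ(D₂) = 0 ∧ λ(D₁) + Σ_{v∈Σ₀} δ(E₁,v) = λ(D₂) + Σ_{v∈Σ₀} δ(E₂,v)`** —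
  gen-5 FILES 4–6 + FILE K3 (`hnf` on both sides) + the two `λ`-identities.

FILE K4 (after T-GV23L p285310 and p06's `DatumDualData.ofSelmer/ofNonPrimitive` land) discharges
`hrecᵢ`, `hdivᵢ` from the record `h23` and turns A240's single place/line hypotheses into `hlines`
(uniqueness of the place above `p` and of the ramified ordinary line), giving A240's statement
VERBATIM with `h23`, `h414` (and the R-D / A40–A41 records as today) as the only named-fact binders.

References: [GreenbergVatsal2000] §2 Prop. (2.8), Remark (2.9), Cor. (2.3), Prop. (2.4), pp. 26–27
(arXiv:math/9906215); [GreenbergLNM1716] Prop. 4.14, Prop. 5.10.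
-/

set_option autoImplicit false

noncomputable section

open scoped Classical NumberField AddSubgroup

open NumberField IsDedekindDomain Field WeierstrassCurve
  Literature.NumberTheory.GaloisRepresentations Literature.NumberTheory.EllipticCurves
  Literature.NumberTheory.EllipticCurves.GreenbergSelmer
  Literature.NumberTheory.EllipticCurves.GreenbergVatsal2000
  Literature.NumberTheory.EllipticCurves.EmertonPollackWeston2006
  Literature.NumberTheory.EllipticCurves.Rank1Residual
  Summit.BirchSwinnertonDyer.Rank1Residual.X2.TorsionComparison
  Summit.BirchSwinnertonDyer.Rank1Residual.X2.GreenbergVatsalTorsion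

namespace Summit.BirchSwinnertonDyer.Rank1Residual.Additive

open Summit.BirchSwinnertonDyer.Rank1Residual.X1.CongruenceTransfer (TorsionIso)
open Summit.BirchSwinnertonDyer.Rank1Residual.Additive.RamifiedOrdinaryLineQuotientModelFree

/-! ## §1. Transport of ONE congruence to `E₁[p^∞][p] ≃+ E₂[p^∞][p]`, with its matching -/

section Transport

variable {p : ℕ} [hp : Fact p.Prime] {W₁ W₂ : WeierstrassCurve ℚ}

/-- **One `Γ_ℚ`-equivariant `e : E₁[p] ≃+ E₂[p]` transported to `θ : E₁[p^∞][p] ≃+ E₂[p^∞][p]`**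
(eisenstein-p2's identifications `E_i[p^∞][p] ≃ E_i[p]`, same points), `Γ_ℚ`-equivariant, such that
at EVERY place `v` and for every pair of local data `L₁`, `L₂` MATCHED by `e` (`P ∈ C₁ ↔ e P ∈ C₂`
on `E₁[p]`), `θ(E₁[p^∞][p] ∩ C₁) = E₂[p^∞][p] ∩ C₂` — the hypothesis `hθL` of the transfer count, for a
SINGLE congruence (gen-5 `map_torsionDatum_plus_eq_of_forall_matching` asked it of every `e`).
[cite: GreenbergVatsal2000, §2 pp. 26–27] -/
theorem exists_transport_of_congruence (e : geomTorsion W₁ (p : ℤ) ≃+ geomTorsion W₂ (p : ℤ))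
    (he : ∀ (σ : absoluteGaloisGroup ℚ) (P : geomTorsion W₁ (p : ℤ)), e (σ • P) = σ • e P) :
    ∃ θ : (W₁.geomPrimaryTorsion p)[(p : ℤ)] ≃+ (W₂.geomPrimaryTorsion p)[(p : ℤ)],
      (∀ (g : absoluteGaloisGroup ℚ) (m : (W₁.geomPrimaryTorsion p)[(p : ℤ)]), θ (g • m) = g • θ m) ∧
      ∀ {v : HeightOneSpectrum (𝓞 ℚ)} (L₁ : LocalDatum ℚ (W₁.geomPrimaryTorsion p) v)
        (L₂ : LocalDatum ℚ (W₂.geomPrimaryTorsion p) v),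
        (∀ P : geomTorsion W₁ (p : ℤ),
          AddSubgroup.inclusion (geomTorsion_le_geomPrimaryTorsion W₁ p) P ∈ L₁.plus ↔
            AddSubgroup.inclusion (geomTorsion_le_geomPrimaryTorsion W₂ p) (e P) ∈ L₂.plus) →
        (torsionDatum L₁ p).plus.map
            (θ : (W₁.geomPrimaryTorsion p)[(p : ℤ)] →+ (W₂.geomPrimaryTorsion p)[(p : ℤ)]) =
          (torsionDatum L₂ p).plus := by
  obtain ⟨j₁, hj₁g, hj₁s⟩ := X2.GreenbergVatsalTransferCurve.nonempty_torsionBy_primaryTorsion_equiv W₁ p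
  obtain ⟨j₂, hj₂g, hj₂s⟩ := X2.GreenbergVatsalTransferCurve.nonempty_torsionBy_primaryTorsion_equiv W₂ p
  have hincl₁ : ∀ x : (W₁.geomPrimaryTorsion p)[(p : ℤ)],
      AddSubgroup.inclusion (geomTorsion_le_geomPrimaryTorsion W₁ p) (j₁ x) =
        (x : W₁.geomPrimaryTorsion p) := fun x ↦ Subtype.ext (by
    rw [AddSubgroup.coe_inclusion]
    have h := hj₁s (j₁ x)
    rw [j₁.symm_apply_apply] at h
    exact h.symm)
  have hincl₂ : ∀ x : (W₂.geomPrimaryTorsion p)[(p : ℤ)],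
      AddSubgroup.inclusion (geomTorsion_le_geomPrimaryTorsion W₂ p) (j₂ x) =
        (x : W₂.geomPrimaryTorsion p) := fun x ↦ Subtype.ext (by
    rw [AddSubgroup.coe_inclusion]
    have h := hj₂s (j₂ x)
    rw [j₂.symm_apply_apply] at h
    exact h.symm)
  have hj₁' : ∀ (g : absoluteGaloisGroup ℚ) (x : (W₁.geomPrimaryTorsion p)[(p : ℤ)]),
      j₁ (g • x) = g • j₁ x := fun g x ↦ Subtype.ext (hj₁g g x)
  have hj₂' : ∀ (g : absoluteGaloisGroup ℚ) (y : W₂.geomTorsion (p : ℤ)),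
      j₂.symm (g • y) = g • j₂.symm y := by
    intro g y
    apply j₂.injective
    rw [j₂.apply_symm_apply]
    apply Subtype.ext
    rw [hj₂g g (j₂.symm y), j₂.apply_symm_apply]
    rfl
  set θ : (W₁.geomPrimaryTorsion p)[(p : ℤ)] ≃+ (W₂.geomPrimaryTorsion p)[(p : ℤ)] :=
    j₁.trans (e.trans j₂.symm) with hθdef
  refine ⟨θ, fun g m ↦ ?_, fun L₁ L₂ hmatch ↦ ?_⟩
  · simp only [hθdef, AddEquiv.trans_apply]
    rw [hj₁', he, hj₂']
  ext c
  simp only [AddSubgroup.mem_map, AddMonoidHom.coe_coe]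
  constructor
  · rintro ⟨c₁, hc₁, rfl⟩
    have hP : AddSubgroup.inclusion (geomTorsion_le_geomPrimaryTorsion W₁ p) (j₁ c₁) ∈ L₁.plus := by
      rw [hincl₁]; exact (AddSubgroup.mem_addSubgroupOf).1 hc₁
    have h := (hmatch (j₁ c₁)).1 hP
    have heP : e (j₁ c₁) = j₂ (θ c₁) := by
      simp only [hθdef, AddEquiv.trans_apply, j₂.apply_symm_apply]
    rw [heP, hincl₂] at h
    exact (AddSubgroup.mem_addSubgroupOf).2 h
  · intro hc
    refine ⟨θ.symm c, ?_, θ.apply_symm_apply c⟩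
    have heP : e (j₁ (θ.symm c)) = j₂ c := by
      rw [hθdef, AddEquiv.symm_trans_apply, AddEquiv.symm_trans_apply, AddEquiv.symm_symm,
        j₁.apply_symm_apply, e.apply_symm_apply]
    have h2 : AddSubgroup.inclusion (geomTorsion_le_geomPrimaryTorsion W₂ p) (e (j₁ (θ.symm c))) ∈
        L₂.plus := by
      rw [heP, hincl₂]; exact (AddSubgroup.mem_addSubgroupOf).1 hc
    have h := (hmatch (j₁ (θ.symm c))).2 h2
    rw [hincl₁] at h
    exact (AddSubgroup.mem_addSubgroupOf).2 h

end Transport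

/-! ## §2. The transfer COUNT along one congruence -/

section Count

variable {p : ℕ} [hp : Fact p.Prime] {W₁ W₂ : WeierstrassCurve ℚ} [W₁.IsElliptic] [W₂.IsElliptic]
  (κ : ZpExtension ℚ p) (S₀ : Set (HeightOneSpectrum (𝓞 ℚ)))

/-- **GV's transfer COUNT along ONE congruence** (`p` odd, any `ℤ_p`-extension `κ`): `E₁, E₂/ℚ`
elliptic, ONE `Γ_ℚ`-equivariant `e : E₁[p] ≃+ E₂[p]`; at every `v ∋ p` ramified ordinary lines
`C_{1,v}`, `C_{2,v}` MATCHED by `e`; `p ∤ #E₁(ℚ)_tors`; `E_i` good outside `S₀ ∪ {p}`. Then there are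
data of ramified ordinary lines with `#(S^{S₀}_{E₁[p^∞]}(ℚ_∞) ⊓ H¹[p]) = #(S^{S₀}_{E₂[p^∞]}(ℚ_∞) ⊓ H¹[p])`
(GV p. 27 "the order of this group is independent of `i`"). The Remark-(2.9) clauses come from
`gr_invariants_eq_zero_of_isRamifiedOrdinaryLine`; the matching clause is for the GIVEN `e` only
(A240's literal hypothesis). [cite: GreenbergVatsal2000, §2 Prop. (2.8), Remark (2.9) and pp. 26–27] -/
theorem exists_data_natCard_gvSelmerInfty_inf_torsion_eq_of_congruence (hp2 : p ≠ 2)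
    (e : geomTorsion W₁ (p : ℤ) ≃+ geomTorsion W₂ (p : ℤ))
    (he : ∀ (σ : absoluteGaloisGroup ℚ) (P : geomTorsion W₁ (p : ℤ)), e (σ • P) = σ • e P)
    (hlines : ∀ (v : HeightOneSpectrum (𝓞 ℚ)) (hv : ((p : ℕ) : 𝓞 ℚ) ∈ v.asIdeal),
      ∃ (L₁ : LocalDatum ℚ (W₁.geomPrimaryTorsion p) v) (L₂ : LocalDatum ℚ (W₂.geomPrimaryTorsion p) v),
        IsRamifiedOrdinaryLine W₁ p L₁ ∧ IsRamifiedOrdinaryLine W₂ p L₂ ∧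
        ∀ P : geomTorsion W₁ (p : ℤ),
          AddSubgroup.inclusion (geomTorsion_le_geomPrimaryTorsion W₁ p) P ∈ L₁.plus ↔
            AddSubgroup.inclusion (geomTorsion_le_geomPrimaryTorsion W₂ p) (e P) ∈ L₂.plus)
    (htors₁ : ¬ p ∣ W₁.torsionOrder)
    (hS₁ : ∀ v : HeightOneSpectrum (𝓞 ℚ), v ∉ S₀ → ((p : ℕ) : 𝓞 ℚ) ∉ v.asIdeal →
      W₁.HasGoodReductionAt v)
    (hS₂ : ∀ v : HeightOneSpectrum (𝓞 ℚ), v ∉ S₀ → ((p : ℕ) : 𝓞 ℚ) ∉ v.asIdeal →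
      W₂.HasGoodReductionAt v) :
    ∃ (L₁ : Data ℚ (W₁.geomPrimaryTorsion p) p) (L₂ : Data ℚ (W₂.geomPrimaryTorsion p) p),
      (∀ v hv, IsRamifiedOrdinaryLine W₁ p (L₁ v hv)) ∧ (∀ v hv, IsRamifiedOrdinaryLine W₂ p (L₂ v hv)) ∧
      (∀ v hv, ∀ P : geomTorsion W₁ (p : ℤ),
          AddSubgroup.inclusion (geomTorsion_le_geomPrimaryTorsion W₁ p) P ∈ (L₁ v hv).plus ↔
            AddSubgroup.inclusion (geomTorsion_le_geomPrimaryTorsion W₂ p) (e P) ∈ (L₂ v hv).plus) ∧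
      Nat.card (gvSelmerInfty κ (W₁.geomPrimaryTorsion p) L₁ S₀ ⊓
          (subgroupH1 κ.kerSubgroup (W₁.geomPrimaryTorsion p))[(p : ℤ)] :
          AddSubgroup (subgroupH1 κ.kerSubgroup (W₁.geomPrimaryTorsion p))) =
        Nat.card (gvSelmerInfty κ (W₂.geomPrimaryTorsion p) L₂ S₀ ⊓
          (subgroupH1 κ.kerSubgroup (W₂.geomPrimaryTorsion p))[(p : ℤ)] :
          AddSubgroup (subgroupH1 κ.kerSubgroup (W₂.geomPrimaryTorsion p))) := by
  choose L₁ L₂ hL using hlines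
  have hT : TorsionIso W₁ W₂ p := ⟨e, he⟩
  have htors₂ : ¬ p ∣ W₂.torsionOrder := not_dvd_torsionOrder_of_torsionIso hT htors₁
  obtain ⟨θ, hθ, hθL⟩ := exists_transport_of_congruence e he
  haveI := finite_fixedPoints_of_not_dvd_torsionOrder W₁ κ htors₁
  haveI := finite_fixedPoints_of_not_dvd_torsionOrder W₂ κ htors₂
  have h := GreenbergVatsalTransferRamified.natCard_gvSelmer_inf_torsion_mul_eq_curve_of_map_plus_eq p
    κ.kerSubgroup W₁ W₂ L₁ L₂ S₀ hS₁ hS₂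
    (fun v hv ↦ fun _ hm ↦ (hL v hv).1.divisible hm)
    (fun v hv ↦ fun _ hm ↦ (hL v hv).2.1.divisible hm)
    (fun v hv ↦ gr_invariants_eq_zero_of_isRamifiedOrdinaryLine hp2 (hL v hv).1 κ)
    (fun v hv ↦ gr_invariants_eq_zero_of_isRamifiedOrdinaryLine hp2 (hL v hv).2.1 κ) θ hθ
    (fun v hv ↦ hθL (L₁ v hv) (L₂ v hv) (hL v hv).2.2)
  rw [natCard_torsionBy_fixedPoints_eq_one W₁ κ htors₁, natCard_torsionBy_fixedPoints_eq_one W₂ κ htors₂,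
    mul_one, mul_one] at h
  exact ⟨L₁, L₂, fun v hv ↦ (hL v hv).1, fun v hv ↦ (hL v hv).2.1, fun v hv ↦ (hL v hv).2.2, h⟩

/-- **`#Sel^{Σ₀}_{E₁}(ℚ_∞)_p[p] = #Sel^{Σ₀}_{E₂}(ℚ_∞)_p[p]` along ONE congruence** (`p` odd, `κ`
cyclotomic): the count above read on the classical non-primitive Selmer groups, the R-D
identification at each `v ∋ p` required of EVERY ramified ordinary line there (per-`κ` form of
cc-typer-2's `RamifiedLineKummerEqAt`; by cc-typer-2's model-free uniqueness one line per `v`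
suffices — `hRD₁`, `hRD₂` below are stated per line to be fed either way).
[cite: GreenbergVatsal2000, §2 Prop. (2.8), Remark (2.9) and pp. 26–27] -/
theorem natCard_torsionBy_nonPrimitiveSelmerInfty_eq_of_congruence (hp2 : p ≠ 2) (hκ : κ.IsCyclotomic)
    (e : geomTorsion W₁ (p : ℤ) ≃+ geomTorsion W₂ (p : ℤ))
    (he : ∀ (σ : absoluteGaloisGroup ℚ) (P : geomTorsion W₁ (p : ℤ)), e (σ • P) = σ • e P)
    (hlines : ∀ (v : HeightOneSpectrum (𝓞 ℚ)) (hv : ((p : ℕ) : 𝓞 ℚ) ∈ v.asIdeal),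
      ∃ (L₁ : LocalDatum ℚ (W₁.geomPrimaryTorsion p) v) (L₂ : LocalDatum ℚ (W₂.geomPrimaryTorsion p) v),
        IsRamifiedOrdinaryLine W₁ p L₁ ∧ IsRamifiedOrdinaryLine W₂ p L₂ ∧
        ∀ P : geomTorsion W₁ (p : ℤ),
          AddSubgroup.inclusion (geomTorsion_le_geomPrimaryTorsion W₁ p) P ∈ L₁.plus ↔
            AddSubgroup.inclusion (geomTorsion_le_geomPrimaryTorsion W₂ p) (e P) ∈ L₂.plus)
    (hRD₁ : ∀ (v : HeightOneSpectrum (𝓞 ℚ)) (hv : ((p : ℕ) : 𝓞 ℚ) ∈ v.asIdeal)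
      (L : LocalDatum ℚ (W₁.geomPrimaryTorsion p) v), IsRamifiedOrdinaryLine W₁ p L →
      L.greenbergKer κ.kerSubgroup = W₁.localKerOver p κ.kerSubgroup (v.adicCompletion ℚ))
    (hRD₂ : ∀ (v : HeightOneSpectrum (𝓞 ℚ)) (hv : ((p : ℕ) : 𝓞 ℚ) ∈ v.asIdeal)
      (L : LocalDatum ℚ (W₂.geomPrimaryTorsion p) v), IsRamifiedOrdinaryLine W₂ p L →
      L.greenbergKer κ.kerSubgroup = W₂.localKerOver p κ.kerSubgroup (v.adicCompletion ℚ))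
    (htors₁ : ¬ p ∣ W₁.torsionOrder)
    (hS₀ : ∀ v ∈ S₀, ((p : ℕ) : 𝓞 ℚ) ∉ v.asIdeal)
    (hS₁ : ∀ v : HeightOneSpectrum (𝓞 ℚ), v ∉ S₀ → ((p : ℕ) : 𝓞 ℚ) ∉ v.asIdeal →
      W₁.HasGoodReductionAt v)
    (hS₂ : ∀ v : HeightOneSpectrum (𝓞 ℚ), v ∉ S₀ → ((p : ℕ) : 𝓞 ℚ) ∉ v.asIdeal →
      W₂.HasGoodReductionAt v) :
    Nat.card ((nonPrimitiveSelmerInfty W₁ κ S₀)[(p : ℤ)]) =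
      Nat.card ((nonPrimitiveSelmerInfty W₂ κ S₀)[(p : ℤ)]) := by
  obtain ⟨L₁, L₂, hL₁, hL₂, -, hcount⟩ :=
    exists_data_natCard_gvSelmerInfty_inf_torsion_eq_of_congruence κ S₀ hp2 e he hlines htors₁ hS₁ hS₂
  rw [natCard_torsionBy_nonPrimitiveSelmerInfty_eq_of_greenbergKer_eq W₁ p κ S₀ hp2 hκ L₁
      (fun v hv ↦ hRD₁ v hv (L₁ v hv) (hL₁ v hv)) hS₀ hS₁,
    natCard_torsionBy_nonPrimitiveSelmerInfty_eq_of_greenbergKer_eq W₂ p κ S₀ hp2 hκ L₂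
      (fun v hv ↦ hRD₂ v hv (L₂ v hv) (hL₂ v hv)) hS₀ hS₂]
  exact hcount

end Count

/-! ## §3. The A240-shaped CORE along one congruence -/

section Core

variable {p : ℕ} [hp : Fact p.Prime] {W₁ W₂ : WeierstrassCurve ℚ} [W₁.IsElliptic] [W₁.IsGloballyMinimal]
  [W₂.IsElliptic] [W₂.IsGloballyMinimal] (κ : ZpExtension ℚ p) {γ : absoluteGaloisGroup ℚ}
  (S₀ : Finset (HeightOneSpectrum (𝓞 ℚ)))

/-- **THE A240-SHAPED CORE along one congruence.** `E₁, E₂/ℚ` globally minimal, `p` odd, `κ`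
cyclotomic with topological generator `γ`, ONE `Γ_ℚ`-equivariant `e : E₁[p] ≃+ E₂[p]` matching
ramified ordinary lines at the place(s) above `p`, R-D identifications for the ramified ordinary
lines of both curves, `p ∤ #E_i(ℚ)_tors`, `Σ₀ ∌ p` a finset outside which (and `p`) both curves are
good; dual data `D₁`, `D₂` (primitive) f.g. torsion with `μ(D₁) = 0`, and non-primitive dual data
`DS₁`, `DS₂` f.g. WITH THE RECORD'S CONSEQUENCES in classical currency (`hrecᵢ`: `X^{Σ₀}_i` torsion,
`μ(X^{Σ₀}_i) = μ(X_i)`, `λ(X^{Σ₀}_i) = λ(X_i) + Σ_{v∈Σ₀} δ_i` — GV Cor. (2.3) + Prop. (2.4), n1011-lit's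
T-GV23L record transported by T-A240-PORT) and the divisibility of `Sel^{Σ₀}_i/Sel_i` (`hdivᵢ`,
ibid. + p. 17), plus Greenberg's Prop. 4.14 record (`h414`, A234). THEN `μ(D₂) = 0` and
`λ(D₁) + Σ_{v∈Σ₀} δ(E₁,v) = λ(D₂) + Σ_{v∈Σ₀} δ(E₂,v)` — A240's conclusion. Chain: `μ(DS₁) = μ(D₁) = 0`
⟹ gen-5 FILE 6 (`μ(D₂) = 0`, primitive) and FILE 4 (`DS₂` torsion, `μ = 0`); K3 on both sides
(`hnf`); FILE 5 (`λ(DS₁) = λ(DS₂)`); the two `λ`-identities of `hrec`.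
[cite: GreenbergVatsal2000, §2 Prop. (2.8), Cor. (2.3), Prop. (2.4) and pp. 26–27]
[cite: GreenbergLNM1716, Prop. 4.14] -/
theorem mu_eq_zero_and_lambda_add_sum_delta_eq_of_congruence (hp2 : p ≠ 2) (hκ : κ.IsCyclotomic)
    (hγ : κ.IsTopGenerator γ)
    (h414 : Greenberg1999.prop414_noFiniteSubmodule_of_not_dvd_torsionOrder)
    (e : geomTorsion W₁ (p : ℤ) ≃+ geomTorsion W₂ (p : ℤ))
    (he : ∀ (σ : absoluteGaloisGroup ℚ) (P : geomTorsion W₁ (p : ℤ)), e (σ • P) = σ • e P)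
    (hlines : ∀ (v : HeightOneSpectrum (𝓞 ℚ)) (hv : ((p : ℕ) : 𝓞 ℚ) ∈ v.asIdeal),
      ∃ (L₁ : LocalDatum ℚ (W₁.geomPrimaryTorsion p) v) (L₂ : LocalDatum ℚ (W₂.geomPrimaryTorsion p) v),
        IsRamifiedOrdinaryLine W₁ p L₁ ∧ IsRamifiedOrdinaryLine W₂ p L₂ ∧
        ∀ P : geomTorsion W₁ (p : ℤ),
          AddSubgroup.inclusion (geomTorsion_le_geomPrimaryTorsion W₁ p) P ∈ L₁.plus ↔
            AddSubgroup.inclusion (geomTorsion_le_geomPrimaryTorsion W₂ p) (e P) ∈ L₂.plus)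
    (hRD₁ : ∀ (v : HeightOneSpectrum (𝓞 ℚ)) (hv : ((p : ℕ) : 𝓞 ℚ) ∈ v.asIdeal)
      (L : LocalDatum ℚ (W₁.geomPrimaryTorsion p) v), IsRamifiedOrdinaryLine W₁ p L →
      L.greenbergKer κ.kerSubgroup = W₁.localKerOver p κ.kerSubgroup (v.adicCompletion ℚ))
    (hRD₂ : ∀ (v : HeightOneSpectrum (𝓞 ℚ)) (hv : ((p : ℕ) : 𝓞 ℚ) ∈ v.asIdeal)
      (L : LocalDatum ℚ (W₂.geomPrimaryTorsion p) v), IsRamifiedOrdinaryLine W₂ p L →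
      L.greenbergKer κ.kerSubgroup = W₂.localKerOver p κ.kerSubgroup (v.adicCompletion ℚ))
    (htors₁ : ¬ p ∣ W₁.torsionOrder) (htors₂ : ¬ p ∣ W₂.torsionOrder)
    (hS₀ : ∀ v ∈ S₀, ((p : ℕ) : 𝓞 ℚ) ∉ v.asIdeal)
    (hS₁ : ∀ v : HeightOneSpectrum (𝓞 ℚ), v ∉ S₀ → ((p : ℕ) : 𝓞 ℚ) ∉ v.asIdeal →
      W₁.HasGoodReductionAt v)
    (hS₂ : ∀ v : HeightOneSpectrum (𝓞 ℚ), v ∉ S₀ → ((p : ℕ) : 𝓞 ℚ) ∉ v.asIdeal →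
      W₂.HasGoodReductionAt v)
    (D₁ : W₁.SelmerDualData κ γ) (D₂ : W₂.SelmerDualData κ γ)
    [Module.Finite (IwasawaAlgebra p) D₁.X] [Module.Finite (IwasawaAlgebra p) D₂.X]
    (hX₁ : D₁.IsTorsion) (hX₂ : D₂.IsTorsion) (hμ₁ : D₁.mu = 0)
    (DS₁ : NonPrimitiveDualData W₁ κ γ (↑S₀ : Set (HeightOneSpectrum (𝓞 ℚ))))
    (DS₂ : NonPrimitiveDualData W₂ κ γ (↑S₀ : Set (HeightOneSpectrum (𝓞 ℚ))))
    [Module.Finite (IwasawaAlgebra p) DS₁.X] [Module.Finite (IwasawaAlgebra p) DS₂.X]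
    (hrec₁ : Module.IsTorsion (IwasawaAlgebra p) DS₁.X ∧ muInvariant p DS₁.X = muInvariant p D₁.X ∧
      lambdaInvariant p DS₁.X = lambdaInvariant p D₁.X + ∑ v ∈ S₀, delta W₁ p v)
    (hrec₂ : Module.IsTorsion (IwasawaAlgebra p) DS₂.X ∧ muInvariant p DS₂.X = muInvariant p D₂.X ∧
      lambdaInvariant p DS₂.X = lambdaInvariant p D₂.X + ∑ v ∈ S₀, delta W₂ p v)
    (hdiv₁ : ∀ s ∈ nonPrimitiveSelmerInfty W₁ κ (↑S₀ : Set (HeightOneSpectrum (𝓞 ℚ))),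
      ∃ t ∈ nonPrimitiveSelmerInfty W₁ κ (↑S₀ : Set (HeightOneSpectrum (𝓞 ℚ))),
        p • t - s ∈ W₁.selmerInfty κ)
    (hdiv₂ : ∀ s ∈ nonPrimitiveSelmerInfty W₂ κ (↑S₀ : Set (HeightOneSpectrum (𝓞 ℚ))),
      ∃ t ∈ nonPrimitiveSelmerInfty W₂ κ (↑S₀ : Set (HeightOneSpectrum (𝓞 ℚ))),
        p • t - s ∈ W₂.selmerInfty κ) :
    D₂.mu = 0 ∧ lambdaInvariant p D₁.X + ∑ v ∈ S₀, delta W₁ p v =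
      lambdaInvariant p D₂.X + ∑ v ∈ S₀, delta W₂ p v := by
  obtain ⟨ht₁, hμS₁, hlamS₁⟩ := hrec₁
  obtain ⟨-, -, hlamS₂⟩ := hrec₂
  have hμS₁' : muInvariant p DS₁.X = 0 := by rw [hμS₁]; exact hμ₁
  -- the count along the congruence
  have hcount := natCard_torsionBy_nonPrimitiveSelmerInfty_eq_of_congruence κ
    (↑S₀ : Set (HeightOneSpectrum (𝓞 ℚ))) hp2 hκ e he hlines hRD₁ hRD₂ htors₁
    (fun v hv ↦ hS₀ v (Finset.mem_coe.mp hv)) (fun v hv hpv ↦ hS₁ v (fun h ↦ hv (Finset.mem_coe.mpr h)) hpv)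
    (fun v hv hpv ↦ hS₂ v (fun h ↦ hv (Finset.mem_coe.mpr h)) hpv)
  -- `μ(D₂) = 0` (primitive, gen-5 FILE 6)
  have hμ₂ : D₂.mu = 0 :=
    (selmer_isTorsion_and_mu_eq_zero_of_natCard_eq κ _ hκ hγ hcount DS₁ ht₁ hμS₁' D₂).2
  -- `hnf` on both sides (K3)
  have hnf₁ := nonPrimitive_noFiniteSubmodule_of_prop414 h414 htors₁ hκ hγ D₁ hX₁ DS₁ hdiv₁
  have hnf₂ := nonPrimitive_noFiniteSubmodule_of_prop414 h414 htors₂ hκ hγ D₂ hX₂ DS₂ hdiv₂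
  -- `λ(DS₁) = λ(DS₂)` (gen-5 FILE 5)
  obtain ⟨-, -, hlam⟩ :=
    nonPrimitive_lambdaInvariant_eq_of_natCard_eq κ _ hcount DS₁ DS₂ ht₁ hμS₁' hnf₁ hnf₂
  refine ⟨hμ₂, ?_⟩
  rw [← hlamS₁, hlam, hlamS₂]

end Core

end Summit.BirchSwinnertonDyer.Rank1Residual.Additive

end
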